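import Summits.CriticalPhenomena.PercolationContinuityZ3.Theorems.PercNearOneGluingNoHeavyLowerTailThreePartitionOneOrBase
import HarnessLib.Audit

/-!
# `NoHeavyLowerTail` (crux stmt-CriticalPhenomena-4575), master-family hierarchy P3 (gen 37): the two POINTWISE INEQUALITIES of the
# one-disjunction theorem — (♥) `W(𝔄,𝔅) ≤ K*(𝔄,𝔅)` and (b) `K*(𝔇,𝔇) ≤ φ(𝔇)` for up-sets of the sub-cube `2^Q`

Support file (seat `prim-masterthm-p3`; `--supports stmt-CriticalPhenomena-4575`; memo
`run/shared/lean/prim/prim-masterthm/FROM-prim-masterthm-p3-g37-ONE-DISJUNCTION.md` §4–§5).  Companion of `…ThreePartitionOneOrBase`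
(`wPat`, `kStar`, `phiPat`, `mu`, `delta`, `klCube`, `one_le_klCube`).
* **(b) `kStar_le_phiPat`**: the diagonal majorant is below the one-copy budget; the slack is `Σ_{t : {t} ∈ 𝔇} δ_t − [∅ ∈ 𝔇]·#{u ⊆ Q, u ≠ ∅} ≥ 0`
  (the discounts of ALL singletons add up to the number of nonempty subsets of `Q`).
* **(♥) `wPat_le_kStar`** (the QUANTITATIVE BASE INEQUALITY): `K* − W = Σ_{u ⊆ Q} (2 − [u≠∅])·klCube 𝔅 𝔄 (Q∖u) − Σ_{t ∈ S} δ_t` in the generic case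
  `∅ ∉ 𝔄 ∪ 𝔅` (`S` = the singletons of `𝔄 ∩ 𝔅`), and every `u` whose complement meets `S` has `klCube ≥ 1` (singleton lemma), which pays
  for the nonempty `u'` whose chosen element lies in `S` via `u' ↦ Q ∖ u'`; the degenerate cases `𝔄 = ⊤` / `𝔅 = ⊤` are direct counts.
HONEST LABEL: elementary counting (exhaustively machine-checked for `|Q| ≤ 5` beforehand, kit j307418); nothing bears on the (closed) crux. [this work]
-/

noncomputable section

open Finset
open scoped symmDiff Classical

namespace Summit.CriticalPhenomena.PercolationContinuityZ3.Theorems.ThreePartition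

variable {ι : Type*} [Fintype ι]

/-! ## Small tools -/

omit [Fintype ι] in
/-- An up-set containing `∅` is everything. [folklore] -/
private theorem upperEqUniv_of_empty_mem {𝔄 : Set (Set ι)} (h𝔄 : IsUpperSet 𝔄) (h : (∅ : Set ι) ∈ 𝔄) : 𝔄 = Set.univ :=
  Set.eq_univ_of_forall fun x => h𝔄 (Set.empty_subset x) h

/-- Summing over the singletons inside `Q`: `Σ_{a ⊆ Q} Σ_{t : a = {t}} g a t = Σ_{t ∈ Q} g {t} t`. [this work] -/
theorem sum_subsetsOf_sum_singleton (Q : Set ι) (g : Set ι → ι → ℤ) :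
    ∑ a ∈ subsetsOf Q, ∑ t ∈ univ.filter (fun t : ι => a = {t}), g a t = ∑ t ∈ univ.filter (fun t : ι => t ∈ Q), g {t} t := by
  rw [Finset.sum_comm' (t' := univ.filter (fun t : ι => t ∈ Q)) (s' := fun t => ({({t} : Set ι)} : Finset (Set ι)))]
  · exact sum_congr rfl fun t _ => sum_singleton _ _
  · intro a t
    simp only [mem_subsetsOf, mem_filter, mem_univ, true_and, mem_singleton]
    constructor
    · rintro ⟨ha, rfl⟩; exact ⟨rfl, Set.singleton_subset_iff.1 ha⟩
    · rintro ⟨rfl, ht⟩; exact ⟨Set.singleton_subset_iff.2 ht, rfl⟩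

/-- The only subset of `F` that is not nonempty is `∅`: `Σ_{u ⊆ F} (1 − [u ≠ ∅]) = 1`. [this work] -/
theorem sum_subsetsOf_one_sub_indZ (F : Set ι) : ∑ u ∈ subsetsOf F, (1 - indZ u.Nonempty) = 1 := by
  have h : ∀ u ∈ subsetsOf F, (1 - indZ u.Nonempty) = if u = ∅ then (1 : ℤ) else 0 := by
    intro u _
    by_cases hu : u = ∅
    · rw [if_pos hu, indZ_of_neg (by rw [hu]; exact Set.not_nonempty_empty)]; ring
    · rw [if_neg hu, indZ_of_pos (Set.nonempty_iff_ne_empty.2 hu)]; ring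
  rw [sum_congr rfl h, sum_ite_eq' (subsetsOf F) (∅ : Set ι) (fun _ => (1 : ℤ))]
  rw [if_pos (mem_subsetsOf.2 (Set.empty_subset F))]

/-- The one-copy weight of a NONEMPTY part: `wdiag Q a = #{u ⊆ Q ∖ a} + 1`. [this work] -/
theorem wdiag_of_nonempty (Q : Set ι) {a : Set ι} (ha : a.Nonempty) : wdiag Q a = (subsetsOf (Q \ a)).card + 1 := by
  unfold wdiag
  rw [indZ_of_pos ha]
  have e : ∀ u ∈ subsetsOf (Q \ a), (2 * (1 : ℤ) - indZ u.Nonempty) = 1 + (1 - indZ u.Nonempty) := fun u _ => by ring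
  rw [sum_congr rfl e, sum_add_distrib, sum_subsetsOf_one_sub_indZ]
  simp

/-- The one-copy weight of the EMPTY part: `wdiag Q ∅ = −#{u ⊆ Q : u ≠ ∅}`. [this work] -/
theorem wdiag_empty (Q : Set ι) : wdiag Q ∅ = - (((subsetsOf Q).filter fun u => u.Nonempty).card : ℤ) := by
  unfold wdiag
  rw [indZ_of_neg Set.not_nonempty_empty, Set.sdiff_empty, card_filter_eq_sum_indZ, ← sum_neg_distrib]
  exact sum_congr rfl fun u _ => by ring

/-- All nonempty subsets of `Q` have their chosen element in `Q`. [this work] -/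
theorem card_filter_chosen_mem (Q : Set ι) :
    ((subsetsOf Q).filter fun u => ∃ h : u.Nonempty, h.some ∈ univ.filter (fun t : ι => t ∈ Q)).card =
      ((subsetsOf Q).filter fun u => u.Nonempty).card := by
  congr 1; ext u
  simp only [mem_filter, mem_subsetsOf, mem_univ, true_and]
  constructor
  · rintro ⟨hu, h, _⟩; exact ⟨hu, h⟩
  · rintro ⟨hu, h⟩; exact ⟨hu, h, hu h.some_mem⟩

/-! ## (b) The diagonal majorant is below the one-copy budget -/

/-- **(b)** `K*(𝔇,𝔇) ≤ φ(𝔇)` for every up-set `𝔇`. [this work] -/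
theorem kStar_le_phiPat (Q : Set ι) {𝔇 : Set (Set ι)} (h𝔇 : IsUpperSet 𝔇) : kStar Q 𝔇 𝔇 ≤ phiPat Q 𝔇 := by
  unfold kStar phiPat
  rw [← sub_nonneg, ← sum_sub_distrib]
  -- termwise: the difference is `[a∈𝔇]·([a=∅]·wdiag ∅ + [a≠∅]·Σ_{t: a={t}} δ_t)`
  have hterm : ∀ a ∈ subsetsOf Q, indZ (a ∈ 𝔇) * wdiag Q a - indZ (a.Nonempty ∧ a ∈ 𝔇 ∧ a ∈ 𝔇) * mu Q a =
      indZ (a ∈ 𝔇 ∧ ¬ a.Nonempty) * wdiag Q a +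
        indZ (a ∈ 𝔇) * ∑ t ∈ univ.filter (fun t : ι => a = {t}), (delta Q t : ℤ) := by
    intro a _
    unfold mu
    by_cases hD : a ∈ 𝔇
    · by_cases hne : a.Nonempty
      · rw [indZ_of_pos hD, indZ_of_pos ⟨hne, hD, hD⟩, indZ_of_neg (fun h => h.2 hne)]; ring
      · have hs : univ.filter (fun t : ι => a = {t}) = ∅ := by
          rw [filter_eq_empty_iff]; intro t _ h; exact hne (h ▸ Set.singleton_nonempty t)
        rw [indZ_of_pos hD, indZ_of_neg (fun h => hne h.1), indZ_of_pos ⟨hD, hne⟩, hs, sum_empty]; ring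
    · rw [indZ_of_neg hD, indZ_of_neg (fun h => hD h.2.1), indZ_of_neg (fun h => hD h.1)]; ring
  rw [sum_congr rfl hterm, sum_add_distrib]
  by_cases h0 : (∅ : Set ι) ∈ 𝔇
  · -- `𝔇 = ⊤`: the singleton discounts add up to the number of nonempty subsets, which is `−wdiag ∅`
    have hU := upperEqUniv_of_empty_mem h𝔇 h0
    have h1 : ∑ a ∈ subsetsOf Q, indZ (a ∈ 𝔇 ∧ ¬ a.Nonempty) * wdiag Q a = wdiag Q ∅ := by
      have e : ∀ a ∈ subsetsOf Q, indZ (a ∈ 𝔇 ∧ ¬ a.Nonempty) * wdiag Q a = if a = ∅ then wdiag Q ∅ else 0 := by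
        intro a _
        by_cases ha : a = ∅
        · rw [if_pos ha, ha, indZ_of_pos ⟨h0, Set.not_nonempty_empty⟩, one_mul]
        · rw [if_neg ha, indZ_of_neg (fun h => h.2 (Set.nonempty_iff_ne_empty.2 ha)), zero_mul]
      rw [sum_congr rfl e, sum_ite_eq' (subsetsOf Q) (∅ : Set ι) (fun _ => wdiag Q ∅), if_pos (mem_subsetsOf.2 (Set.empty_subset Q))]
    have h2 : ∑ a ∈ subsetsOf Q, indZ (a ∈ 𝔇) * ∑ t ∈ univ.filter (fun t : ι => a = {t}), (delta Q t : ℤ) =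
        (((subsetsOf Q).filter fun u => u.Nonempty).card : ℤ) := by
      have e : ∀ a ∈ subsetsOf Q, indZ (a ∈ 𝔇) * ∑ t ∈ univ.filter (fun t : ι => a = {t}), (delta Q t : ℤ) =
          ∑ t ∈ univ.filter (fun t : ι => a = {t}), (delta Q t : ℤ) := by
        intro a _; rw [hU, indZ_of_pos (Set.mem_univ a), one_mul]
      rw [sum_congr rfl e, sum_subsetsOf_sum_singleton Q (fun _ t => (delta Q t : ℤ)), sum_delta, card_filter_chosen_mem]
    rw [h1, h2, wdiag_empty]; simp
  · -- `∅ ∉ 𝔇`: every term is nonnegative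
    have h1 : ∑ a ∈ subsetsOf Q, indZ (a ∈ 𝔇 ∧ ¬ a.Nonempty) * wdiag Q a = 0 := by
      refine sum_eq_zero fun a _ => ?_
      rw [indZ_of_neg, zero_mul]
      rintro ⟨haD, hne⟩
      exact hne (Set.nonempty_iff_ne_empty.2 fun h => h0 (h ▸ haD))
    rw [h1, zero_add]
    refine sum_nonneg fun a _ => mul_nonneg (indZ_nonneg _) (sum_nonneg fun t _ => ?_)
    exact_mod_cast Nat.zero_le _

/-! ## (♥) The quantitative base inequality `W ≤ K*` -/

omit [Fintype ι] in
/-- `indZ` respects logical equivalence. [this work] -/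
theorem indZ_congr {p q : Prop} (h : p ↔ q) : indZ p = indZ q := by
  unfold indZ; by_cases hp : p
  · rw [if_pos hp, if_pos (h.1 hp)]
  · rw [if_neg hp, if_neg (fun hq => hp (h.2 hq))]

omit [Fintype ι] in
/-- `(Q \ u) \ a = (Q \ a) \ u`. [folklore] -/
theorem sdiff_sdiff_comm' (Q u a : Set ι) : (Q \ u) \ a = (Q \ a) \ u := by
  ext c; simp only [Set.mem_sdiff]; tauto

/-- The singletons of `𝔄 ∩ 𝔅` inside `Q`. [this work] -/
def singSet (Q : Set ι) (𝔄 𝔅 : Set (Set ι)) : Finset ι :=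
  univ.filter fun t : ι => t ∈ Q ∧ ({t} : Set ι) ∈ 𝔄 ∧ ({t} : Set ι) ∈ 𝔅

/-- Membership in `singSet`. [this work] -/
theorem mem_singSet {Q : Set ι} {𝔄 𝔅 : Set (Set ι)} {t : ι} :
    t ∈ singSet Q 𝔄 𝔅 ↔ t ∈ Q ∧ ({t} : Set ι) ∈ 𝔄 ∧ ({t} : Set ι) ∈ 𝔅 := by
  unfold singSet; simp only [mem_filter, mem_univ, true_and]

omit [Fintype ι] in
/-- Pointwise bookkeeping: `[A ∧ R]·(2[A] − y) = [A ∧ R]·(2 − y)`. [this work] -/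
theorem indZ_and_mul_two_sub (A R : Prop) (y : ℤ) : indZ (A ∧ R) * (2 * indZ A - y) = indZ (A ∧ R) * (2 - y) := by
  by_cases h : A ∧ R
  · rw [indZ_of_pos h, indZ_of_pos h.1]; ring
  · rw [indZ_of_neg h]; ring

/-- **`K*` expanded**: `K*(𝔄,𝔅) = Σ_{u ⊆ Q} Σ_{a ⊆ Q∖u} [a ≠ ∅, a ∈ 𝔄 ∩ 𝔅]·(2 − [u ≠ ∅]) − Σ_{t ∈ S} δ_t`. [this work] -/
theorem kStar_eq (Q : Set ι) (𝔄 𝔅 : Set (Set ι)) :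
    kStar Q 𝔄 𝔅 = patSum Q (fun u a => indZ (a.Nonempty ∧ a ∈ 𝔄 ∧ a ∈ 𝔅) * (2 - indZ u.Nonempty))
      - ∑ t ∈ singSet Q 𝔄 𝔅, (delta Q t : ℤ) := by
  -- the `wdiag` part, with parts 1 and 3 exchanged
  have h1 : ∑ a ∈ subsetsOf Q, indZ (a.Nonempty ∧ a ∈ 𝔄 ∧ a ∈ 𝔅) * wdiag Q a =
      patSum Q (fun u a => indZ (a.Nonempty ∧ a ∈ 𝔄 ∧ a ∈ 𝔅) * (2 - indZ u.Nonempty)) := by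
    rw [patSum_comm]
    unfold patSum wdiag
    refine sum_congr rfl fun a _ => ?_
    rw [mul_sum]
    refine sum_congr rfl fun u _ => ?_
    exact indZ_and_mul_two_sub _ _ _
  -- the discount part: only singletons carry a discount
  have h2 : ∑ a ∈ subsetsOf Q, indZ (a.Nonempty ∧ a ∈ 𝔄 ∧ a ∈ 𝔅) * ∑ t ∈ univ.filter (fun t : ι => a = {t}), (delta Q t : ℤ) =
      ∑ t ∈ singSet Q 𝔄 𝔅, (delta Q t : ℤ) := by
    rw [show (∑ a ∈ subsetsOf Q, indZ (a.Nonempty ∧ a ∈ 𝔄 ∧ a ∈ 𝔅) * ∑ t ∈ univ.filter (fun t : ι => a = {t}), (delta Q t : ℤ))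
        = ∑ a ∈ subsetsOf Q, ∑ t ∈ univ.filter (fun t : ι => a = {t}), indZ (a.Nonempty ∧ a ∈ 𝔄 ∧ a ∈ 𝔅) * (delta Q t : ℤ)
        from sum_congr rfl fun a _ => mul_sum _ _ _]
    rw [sum_subsetsOf_sum_singleton Q (fun a t => indZ (a.Nonempty ∧ a ∈ 𝔄 ∧ a ∈ 𝔅) * (delta Q t : ℤ))]
    have hS : singSet Q 𝔄 𝔅 = (univ.filter fun t : ι => t ∈ Q).filter (fun t => ({t} : Set ι) ∈ 𝔄 ∧ ({t} : Set ι) ∈ 𝔅) := by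
      ext t; simp only [singSet, mem_filter, mem_univ, true_and]
    rw [hS, Finset.sum_filter (fun t => ({t} : Set ι) ∈ 𝔄 ∧ ({t} : Set ι) ∈ 𝔅)]
    refine sum_congr rfl fun t _ => ?_
    by_cases ht : ({t} : Set ι) ∈ 𝔄 ∧ ({t} : Set ι) ∈ 𝔅
    · rw [if_pos ht, indZ_of_pos ⟨Set.singleton_nonempty t, ht⟩, one_mul]
    · rw [if_neg ht, indZ_of_neg (fun h => ht h.2), zero_mul]
  unfold kStar mu
  rw [← h1, ← h2, ← sum_sub_distrib]
  exact sum_congr rfl fun a _ => by ring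

/-- The discounted sets are few: `Σ_{t ∈ S} δ_t ≤ #{u ⊆ Q : Q ∖ u contains a singleton of 𝔄 ∩ 𝔅}` (`u' ↦ Q ∖ u'`). [this work] -/
theorem sum_delta_singSet_le (Q : Set ι) (𝔄 𝔅 : Set (Set ι)) :
    ∑ t ∈ singSet Q 𝔄 𝔅, (delta Q t : ℤ) ≤
      (((subsetsOf Q).filter fun u => ∃ t, t ∈ Q \ u ∧ ({t} : Set ι) ∈ 𝔄 ∧ ({t} : Set ι) ∈ 𝔅).card : ℤ) := by
  rw [sum_delta]
  have h : ((subsetsOf Q).filter fun u => ∃ h : u.Nonempty, h.some ∈ singSet Q 𝔄 𝔅).card ≤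
      ((subsetsOf Q).filter fun u => ∃ t, t ∈ Q \ u ∧ ({t} : Set ι) ∈ 𝔄 ∧ ({t} : Set ι) ∈ 𝔅).card := by
    refine card_le_card_of_injOn (fun u => Q \ u) (fun u hu => ?_) (fun u hu u' hu' h => ?_)
    · rw [mem_coe, mem_filter, mem_subsetsOf] at hu
      obtain ⟨huQ, hne, ht⟩ := hu
      rw [mem_singSet] at ht
      rw [mem_coe, mem_filter, mem_subsetsOf]
      refine ⟨Set.sdiff_subset, hne.some, ?_, ht.2⟩
      rw [Set.sdiff_sdiff_cancel_left huQ]; exact hne.some_mem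
    · rw [mem_coe, mem_filter, mem_subsetsOf] at hu hu'
      have h' : Q \ u = Q \ u' := h
      have e : Q \ (Q \ u) = Q \ (Q \ u') := by rw [h']
      rwa [Set.sdiff_sdiff_cancel_left hu.1, Set.sdiff_sdiff_cancel_left hu'.1] at e
  exact_mod_cast h

/-- **(♥), generic case** `∅ ∉ 𝔄 ∪ 𝔅`. [this work] -/
theorem wPat_le_kStar_of_not_mem (Q : Set ι) {𝔄 𝔅 : Set (Set ι)} (h𝔄 : IsUpperSet 𝔄) (h𝔅 : IsUpperSet 𝔅)
    (h0A : (∅ : Set ι) ∉ 𝔄) (h0B : (∅ : Set ι) ∉ 𝔅) : wPat Q 𝔄 𝔅 ≤ kStar Q 𝔄 𝔅 := by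
  rw [kStar_eq]
  -- `W` in the generic case
  have hW : wPat Q 𝔄 𝔅 = patSum Q (fun u a => (2 - indZ u.Nonempty) * indZ (a ∈ 𝔅 ∧ (Q \ u) \ a ∈ 𝔄)) := by
    unfold wPat patSum wcoef
    refine sum_congr rfl fun u _ => sum_congr rfl fun a _ => ?_
    dsimp only
    by_cases hab : a ∈ 𝔅 ∧ (Q \ u) \ a ∈ 𝔄
    · have hbne : ((Q \ u) \ a).Nonempty := Set.nonempty_iff_ne_empty.2 fun h => h0A (h ▸ hab.2)
      have hane : a.Nonempty := Set.nonempty_iff_ne_empty.2 fun h => h0B (h ▸ hab.1)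
      rw [indZ_of_pos hab, indZ_of_pos hab.1, indZ_of_pos hab.2, indZ_of_pos hbne, indZ_of_pos hane]; ring
    · rw [indZ_of_neg hab]
      by_cases hb : (Q \ u) \ a ∈ 𝔄
      · rw [indZ_of_neg (fun ha => hab ⟨ha, hb⟩)]; ring
      · rw [indZ_of_neg hb]; ring
  -- `K* − W` as Kleitman slacks
  have hK : patSum Q (fun u a => indZ (a.Nonempty ∧ a ∈ 𝔄 ∧ a ∈ 𝔅) * (2 - indZ u.Nonempty))
      - patSum Q (fun u a => (2 - indZ u.Nonempty) * indZ (a ∈ 𝔅 ∧ (Q \ u) \ a ∈ 𝔄))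
      = ∑ u ∈ subsetsOf Q, (2 - indZ u.Nonempty) * klCube 𝔅 𝔄 (Q \ u) := by
    unfold patSum
    rw [← sum_sub_distrib]
    refine sum_congr rfl fun u _ => ?_
    rw [klCube_eq_sum, mul_sum, ← sum_sub_distrib]
    refine sum_congr rfl fun a _ => ?_
    dsimp only
    have e : indZ (a.Nonempty ∧ a ∈ 𝔄 ∧ a ∈ 𝔅) = indZ (a ∈ 𝔅 ∧ a ∈ 𝔄) := indZ_congr
      ⟨fun h => ⟨h.2.2, h.2.1⟩, fun h => ⟨Set.nonempty_iff_ne_empty.2 fun h' => h0B (h' ▸ h.1), h.2, h.1⟩⟩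
    rw [e]; ring
  -- the termwise lower bound `(2 − [u≠∅])·klCube ≥ [Q∖u meets S]`
  have hsum : 0 ≤ ∑ u ∈ subsetsOf Q, ((2 - indZ u.Nonempty) * klCube 𝔅 𝔄 (Q \ u)
      - indZ (∃ t, t ∈ Q \ u ∧ ({t} : Set ι) ∈ 𝔄 ∧ ({t} : Set ι) ∈ 𝔅)) := by
    refine sum_nonneg fun u _ => ?_
    have hkl := klCube_nonneg h𝔅 h𝔄 (Q \ u)
    have hx : 0 ≤ 1 - indZ u.Nonempty := by have := indZ_le_one u.Nonempty; linarith
    by_cases ht : ∃ t, t ∈ Q \ u ∧ ({t} : Set ι) ∈ 𝔄 ∧ ({t} : Set ι) ∈ 𝔅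
    · rw [indZ_of_pos ht]
      obtain ⟨t, htQ, htA, htB⟩ := ht
      have h1 := one_le_klCube h𝔅 h𝔄 h0B h0A htQ htB htA
      nlinarith
    · rw [indZ_of_neg ht]; nlinarith
  rw [sum_sub_distrib, ← hK, ← card_filter_eq_sum_indZ] at hsum
  have hd := sum_delta_singSet_le Q 𝔄 𝔅
  rw [hW]
  linarith

/-- **(♥), degenerate case** `𝔄 = ⊤`: `K* − W = #{a ⊆ Q : a ≠ ∅, a ∈ 𝔅} − Σ_{t : {t} ∈ 𝔅} δ_t ≥ 0` (a nonempty `u` whose chosen element `t`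
has `{t} ∈ 𝔅` lies in `𝔅`). [this work] -/
theorem wPat_le_kStar_univ (Q : Set ι) {𝔅 : Set (Set ι)} (h𝔅 : IsUpperSet 𝔅) :
    wPat Q (Set.univ : Set (Set ι)) 𝔅 ≤ kStar Q (Set.univ : Set (Set ι)) 𝔅 := by
  rw [kStar_eq]
  -- the `[P₂ ≠ ∅]` and `[P₁ ≠ ∅]` parts of `W` cancel (reflection `u ↦ (Q∖a)∖u` for fixed `a`)
  have w1 : patSum Q (fun u a => indZ ((Q \ u) \ a).Nonempty * indZ (a ∈ 𝔅)) =
      patSum Q (fun u a => indZ u.Nonempty * indZ (a ∈ 𝔅)) := by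
    rw [patSum_comm Q (fun u a => indZ ((Q \ u) \ a).Nonempty * indZ (a ∈ 𝔅)),
      patSum_comm Q (fun u a => indZ u.Nonempty * indZ (a ∈ 𝔅))]
    unfold patSum
    refine sum_congr rfl fun a _ => ?_
    dsimp only
    rw [← sum_subsetsOf_reflect (Q \ a) (fun u => indZ u.Nonempty * indZ (a ∈ 𝔅))]
    refine sum_congr rfl fun u _ => ?_
    rw [sdiff_sdiff_comm']
  have hW : wPat Q (Set.univ : Set (Set ι)) 𝔅 = patSum Q (fun u a => indZ a.Nonempty * indZ (a ∈ 𝔅)) := by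
    have e : wPat Q (Set.univ : Set (Set ι)) 𝔅 = patSum Q (fun u a => indZ a.Nonempty * indZ (a ∈ 𝔅))
        + (patSum Q (fun u a => indZ ((Q \ u) \ a).Nonempty * indZ (a ∈ 𝔅))
          - patSum Q (fun u a => indZ u.Nonempty * indZ (a ∈ 𝔅))) := by
      unfold wPat patSum wcoef
      rw [← sum_sub_distrib, ← sum_add_distrib]
      refine sum_congr rfl fun u _ => ?_
      rw [← sum_sub_distrib, ← sum_add_distrib]
      refine sum_congr rfl fun a _ => ?_
      dsimp only
      rw [indZ_of_pos (Set.mem_univ _)]; ring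
    rw [e, w1, sub_self, add_zero]
  -- `K* − W = #{a ≠ ∅, a ∈ 𝔅} − Σ δ`
  have hK : patSum Q (fun u a => indZ (a.Nonempty ∧ a ∈ (Set.univ : Set (Set ι)) ∧ a ∈ 𝔅) * (2 - indZ u.Nonempty))
      - patSum Q (fun u a => indZ a.Nonempty * indZ (a ∈ 𝔅))
      = (((subsetsOf Q).filter fun a => a.Nonempty ∧ a ∈ 𝔅).card : ℤ) := by
    rw [patSum_comm Q (fun u a => indZ (a.Nonempty ∧ a ∈ (Set.univ : Set (Set ι)) ∧ a ∈ 𝔅) * (2 - indZ u.Nonempty)),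
      patSum_comm Q (fun u a => indZ a.Nonempty * indZ (a ∈ 𝔅)), card_filter_eq_sum_indZ]
    unfold patSum
    rw [← sum_sub_distrib]
    refine sum_congr rfl fun a _ => ?_
    dsimp only
    have e1 : indZ (a.Nonempty ∧ a ∈ (Set.univ : Set (Set ι)) ∧ a ∈ 𝔅) = indZ (a.Nonempty ∧ a ∈ 𝔅) :=
      indZ_congr ⟨fun h => ⟨h.1, h.2.2⟩, fun h => ⟨h.1, Set.mem_univ _, h.2⟩⟩
    have e2 : indZ a.Nonempty * indZ (a ∈ 𝔅) = indZ (a.Nonempty ∧ a ∈ 𝔅) := (indZ_and _ _).symm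
    rw [← sum_sub_distrib]
    rw [show (∑ u ∈ subsetsOf (Q \ a), (indZ (a.Nonempty ∧ a ∈ (Set.univ : Set (Set ι)) ∧ a ∈ 𝔅) * (2 - indZ u.Nonempty)
          - indZ a.Nonempty * indZ (a ∈ 𝔅)))
        = indZ (a.Nonempty ∧ a ∈ 𝔅) * ∑ u ∈ subsetsOf (Q \ a), (1 - indZ u.Nonempty) from by
          rw [mul_sum]; refine sum_congr rfl fun u _ => ?_; rw [e1, e2]; ring]
    rw [sum_subsetsOf_one_sub_indZ, mul_one]
  -- the discounted sets all lie in `𝔅`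
  have hd : ∑ t ∈ singSet Q (Set.univ : Set (Set ι)) 𝔅, (delta Q t : ℤ) ≤
      (((subsetsOf Q).filter fun a => a.Nonempty ∧ a ∈ 𝔅).card : ℤ) := by
    rw [sum_delta]
    exact_mod_cast card_le_card (fun u hu => by
      rw [mem_filter] at hu ⊢
      obtain ⟨huQ, hne, ht⟩ := hu
      rw [mem_singSet] at ht
      exact ⟨huQ, hne, h𝔅 (Set.singleton_subset_iff.2 hne.some_mem) ht.2.2⟩)
  rw [hW]
  linarith

/-- `W` is symmetric (reflect the second and third parts). [this work] -/
theorem wPat_comm (Q : Set ι) (𝔄 𝔅 : Set (Set ι)) : wPat Q 𝔄 𝔅 = wPat Q 𝔅 𝔄 := by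
  unfold wPat patSum
  refine sum_congr rfl fun u hu => ?_
  rw [← sum_subsetsOf_reflect (Q \ u) (fun a => wcoef Q u a * (indZ ((Q \ u) \ a ∈ 𝔅) * indZ (a ∈ 𝔄)))]
  refine sum_congr rfl fun a ha => ?_
  rw [mem_subsetsOf] at ha
  dsimp only
  unfold wcoef
  rw [Set.sdiff_sdiff_cancel_left ha]; ring

/-- `K*` is symmetric. [this work] -/
theorem kStar_comm (Q : Set ι) (𝔄 𝔅 : Set (Set ι)) : kStar Q 𝔄 𝔅 = kStar Q 𝔅 𝔄 := by
  unfold kStar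
  refine sum_congr rfl fun a _ => ?_
  rw [indZ_congr (show a.Nonempty ∧ a ∈ 𝔄 ∧ a ∈ 𝔅 ↔ a.Nonempty ∧ a ∈ 𝔅 ∧ a ∈ 𝔄 from
    ⟨fun h => ⟨h.1, h.2.2, h.2.1⟩, fun h => ⟨h.1, h.2.2, h.2.1⟩⟩)]

/-- **(♥) THE QUANTITATIVE BASE INEQUALITY**: `W(𝔄,𝔅) ≤ K*(𝔄,𝔅)` for all up-sets `𝔄, 𝔅` — the two-copy weight of a pair of signatures is
dominated by the diagonal majorant (memo §4–§5; exhaustively checked for `|Q| ≤ 5` before formalisation). [this work] -/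
theorem wPat_le_kStar (Q : Set ι) {𝔄 𝔅 : Set (Set ι)} (h𝔄 : IsUpperSet 𝔄) (h𝔅 : IsUpperSet 𝔅) :
    wPat Q 𝔄 𝔅 ≤ kStar Q 𝔄 𝔅 := by
  by_cases h0A : (∅ : Set ι) ∈ 𝔄
  · rw [upperEqUniv_of_empty_mem h𝔄 h0A]; exact wPat_le_kStar_univ Q h𝔅
  · by_cases h0B : (∅ : Set ι) ∈ 𝔅
    · rw [wPat_comm, kStar_comm, upperEqUniv_of_empty_mem h𝔅 h0B]; exact wPat_le_kStar_univ Q h𝔄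
    · exact wPat_le_kStar_of_not_mem Q h𝔄 h𝔅 h0A h0B

end Summit.CriticalPhenomena.PercolationContinuityZ3.Theorems.ThreePartition

end
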